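/-
Copyright: h21 programme. Stub-ideation companion (k = 2, GENERATION 5) — NOT a route file, NOT a
Theorems file. Elaboration sanity: helper SIGNATURES with `sorry`, plus four PROVED identities.
-/
import HarnessLib
import Literature.NumberTheory.Automorphic.CDTTheorem712
import Literature.NumberTheory.EllipticCurves.ModFiveCongruenceHesseFamily
import Literature.NumberTheory.EllipticCurves.ModThreeReducibleIffPsi3Root
import Literature.NumberTheory.EllipticCurves.TorsionFrobenius
import Literature.NumberTheory.EllipticCurves.TorsionFrobeniusChebotarevProofs
import Literature.NumberTheory.EllipticCurves.SemistableModPImageReducibleProofs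
import Literature.NumberTheory.EllipticCurves.TateCurve.NumberFieldUniformizationTwistedTateJ
import Literature.NumberTheory.EllipticCurves.MultiplicativeTransvectionPrimeToVProofs
import Literature.NumberTheory.GaloisRepresentations.DecompositionGroupOfCompletion
import Literature.NumberTheory.DiophantineGeometry.MinimalDiscriminant

/-!
# Stub-ideation k = 2, GENERATION 5 (HOME FAMILY 2 — RESHAPE) for `stub_switch` of crux `FreyModularity`

Companion to `STUB-IDEAS-stub_switch-2.md` (gen 5, supersedes gen 4).  Same road — NONSPLIT-CUSP
FORCING: target `CuspForcedSource` (gen 2, ns `…StubSwitchIdeas2G2`) and its PROVED glue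
`stubSwitch_of_cuspForcedSource`.  Only the helpers that are NEW or RE-CUT in generation 5 are typed
here; everything else is cited BY NAME from the gen-2/3/4 companions
(`STUB_IDEAS_stub_switch_2_Sketch.lean`, `…_2g3_Sketch.lean`, `…_2g4_Sketch.lean`).

GEN-5 RESHAPES (each removes a helper or turns an M into an S):
* (Σ) **square trick.**  The auxiliary Galois element is `σ₀ := τ²` with `ρ̄_{W,5}(τ)² = −1`.  Then
  `ρ̄(σ₀) = −1`, `χ̄₅(σ₀) = det(−1) = 1`, `χ̄₃(σ₀) = χ̄₃(τ)² = 1`, and `ψ(σ₀) = ψ(τ)² = 1` for EVERY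
  character `ψ` with values in a group of exponent `2` — so gen-4's G1a (`−1 ∈ ⁅G,G⁆`) becomes the
  one-element statement G1a′ (`∃ g ∈ G, g² = −1`), G1b loses the commutator/abelianisation API, and R4
  is consumed at `σ = φ·σ₀⁻¹` (gen-4 `helper_quadratic_character_cyclotomic` verbatim).
* (V) **valuation trick.**  `v_q(a³ − b²) = 5` forces `q ∤ a` (5 is neither `≡ 0 mod 2` nor `mod 3` nor
  `≥ 6`): L1 (member multiplicative at `q`, `v_q(Δ_min) = 5`) needs NO resultant `Res(𝔠₄, 𝔇)` and no
  integrality beyond `q ∤ 2·3·5·11` (the only denominators of `𝔠₄, 𝔠₆` are `17424 = 2⁴3²11²`, `240`).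
* (L0) **the syzygy is now kernel-certified**: `hesse_syzygy_five_m1` below is PROVED by
  `field_simp; ring` (farm: rc 0, 73 s wall), hence `Δ(E_{l,1}) = 2⁶3⁹(c₄³−c₆²)𝔇(l,1)⁵` (PROVED).
* (F) exact constants (this seat, `calc/disc_D_exact.py`, exact integer arithmetic, 93 + 153 points,
  rigorous by weighted homogeneity): `disc_λ 𝔇(c₄,c₆;λ,1) = +2¹³²·3⁶⁶·5²⁵·(c₄³−c₆²)²²` and
  `Res_λ(17424𝔠₄(λ,1), 𝔇(λ,1)) = 2²⁶⁴·3¹³²·5⁵⁰·11²⁴·(c₄³−c₆²)⁴⁴` (the latter no longer needed, by (V)).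
* (C) census certificate for G1a′ (`calc/g1a_census.py`, exhaustive over the 466 subgroups of
  `GL₂(𝔽₅)`): admissible `G` = 4 classes (orders 32, 48, 96, 480); each contains `g` with `g² = −1`.
-/

set_option linter.dupNamespace false
set_option linter.unusedVariables false

noncomputable section

open scoped NumberField
open Literature.NumberTheory.EllipticCurves Literature.NumberTheory.EllipticCurves.HesseFamilyFive
open Literature.NumberTheory.Automorphic Literature.NumberTheory.GaloisRepresentations
open Literature.NumberTheory.Automorphic.BCDT WeierstrassCurve Field NumberField IsDedekindDomain Matrix

namespace Summit.ABC.ABC.Cruxes.FreyModularity.StubSwitchK2G5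

/-- Member `E_{l,m}` of Fisher's direct `5`-congruence family of `y² = x³ − 27c₄x − 54c₆`. -/
abbrev member (c₄ c₆ l m : ℚ) : WeierstrassCurve ℚ :=
  ⟨0, 0, 0, -27 * C4 c₄ c₆ l m, -54 * C6 c₄ c₆ l m⟩

/-- The `c₄c₆`-model (= the member at `(l:m) = (1:0)`). -/
abbrev base (c₄ c₆ : ℚ) : WeierstrassCurve ℚ := ⟨0, 0, 0, -27 * c₄, -54 * c₆⟩

/-! ## (Σ) the square trick: `σ₀ = τ²` -/

/-- **G1a′ (S/M−, pure finite group theory in `GL₂(𝔽₅)`; replaces gen-4 `NegOneMemCommutator`).**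
`G ≤ GL₂(𝔽₅)` with `det G = 𝔽₅ˣ`, `H ≤ G` with `det(H)² = 1`, `H` without a common `𝔽₅`-eigenline and
non-abelian ⇒ some `g ∈ G` has `g² = −1`.  Plan (`G₁ := G ∩ SL₂`): if `4 ∣ #G₁`, a subgroup of order 4
of `SL₂(𝔽₅)` is cyclic (unique involution `−1`, gen-4 `helper_involution_SL2_F5`), so `g` of order 4 has
`g² = −1`; else `#G₁ ∈ {1,2,3,5,6,10}` is cyclic: `5 ∣ #G₁` ⇒ its unipotent `C₅` is normal in `G` ⇒
common eigenline ✗; `#G₁ ∣ 2` ⇒ `#H ≤ 4`, abelian ✗; `3 ∣ #G₁` ⇒ `G ≤ N(⟨s⟩) ≤ N(C_ns)` and for `g ∈ G`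
with `det g = 2`: `(g⁶)² = −1` (`g ∈ C_ns`: `g⁶ = N(g) = 2`; `g ∉ C_ns`: `g² = c ∈ C_ns`, `N(c) = −1`,
`c⁶ = −1`).  CERTIFICATE: `calc/g1a_census.py` (exhaustive, 0 failures).  The determinant hypothesis
is NECESSARY (`H = S₃ ⊂ N(C_ns)` alone has no such `g`) — honours `Disproof.switch_false_without_det`. -/
def NegOneIsSquare : Prop :=
  ∀ (G H : Subgroup (GL (Fin 2) (ZMod 5))), H ≤ G →
    (∀ d : (ZMod 5)ˣ, ∃ g ∈ G, Matrix.GeneralLinearGroup.det g = d) →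
    (∀ h ∈ H, Matrix.GeneralLinearGroup.det h ^ 2 = 1) →
    (∀ w : Fin 2 → ZMod 5, w ≠ 0 → ∃ h ∈ H, ∀ c : ZMod 5,
      (h : Matrix (Fin 2) (Fin 2) (ZMod 5)) *ᵥ w ≠ c • w) →
    (∃ h₁ ∈ H, ∃ h₂ ∈ H, h₁ * h₂ ≠ h₂ * h₁) →
    ∃ g ∈ G, g * g = -1

theorem helper_exists_sq_eq_neg_one : NegOneIsSquare := by
  sorry

/-- **G1′ (S glue, replaces gen-4 G1b): a Galois element whose SQUARE is `−1` on `W[5]`.**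
`G = range ρ̄`, `H = ρ̄(Γ_{ℚ(√5)})`: `det ρ̄ = χ̄₅` onto
(`det_eq_modPCyclotomicCharacter_of_isTorsionGaloisRep_holds`, `modNCyclotomicCharacter_rat_surjective`),
`χ̄₅² = 1` on `Γ_{ℚ(√5)}` (Theorems PROVED `sq_modPCyclotomicCharacter_eq_one_of_mem_range`), no common
eigenline / non-abelian from `IsAbsIrreducibleOverSqrt 5` (`exists_not_eigenline_of_isAbsolutelyIrreducible`,
`FramedRep.exists_mul_ne_mul_of_isAbsolutelyIrreducible`); G1a′ gives `ρ̄(τ)² = −1`, and the frame `e` of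
`IsTorsionGaloisRep` turns `(g*g) *ᵥ v = −v` into `τ • (τ • P) = −P`. -/
theorem helper_exists_tau_sq_eq_neg (hG : NegOneIsSquare) (W : WeierstrassCurve ℚ) [W.IsElliptic]
    (ρ : ModPGaloisRep ℚ (ZMod 5) 2) (hρ : W.IsTorsionGaloisRep 5 ρ)
    (hirr : ρ.IsAbsIrreducibleOverSqrt 5) :
    ∃ τ : absoluteGaloisGroup ℚ, ∀ P : W.geomTorsion 5, τ • (τ • P) = -P := by
  sorry

/-- **XS (PROVED, 2 lines): a character with values in a group of exponent `2` kills every square.**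
This is the whole point of (Σ): applied to the isogeny character `r` of a putatively reducible
`E[3]` (values in `(ℤ/3)ˣ`), to `χ̄₃`, and inside R4. -/
theorem helper_char_sq_eq_one {Γ M : Type*} [Group Γ] [CommGroup M] (hM : ∀ x : M, x ^ 2 = 1)
    (ψ : Γ →* M) (τ : Γ) : ψ (τ * τ) = 1 := by
  rw [map_mul, ← sq]; exact hM _

/-- `(ℤ/3)ˣ` has exponent `2` (PROVED, `decide`). -/
theorem helper_unitsZMod3_sq (x : (ZMod 3)ˣ) : x ^ 2 = 1 := by
  revert x; decide

/-- **XS₅ (S−): `χ̄₅(τ²) = 1`** (`det ρ̄(τ)² = det(ρ̄(τ)²) = det(−1) = 1`, `det ρ̄ = χ̄₅` by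
`det_eq_modPCyclotomicCharacter_of_isTorsionGaloisRep_holds`). -/
theorem helper_chi5_tau_sq (W : WeierstrassCurve ℚ) [W.IsElliptic] (ρ : ModPGaloisRep ℚ (ZMod 5) 2)
    (hρ : W.IsTorsionGaloisRep 5 ρ) {τ : absoluteGaloisGroup ℚ}
    (hτ : ∀ P : W.geomTorsion 5, τ • (τ • P) = -P) :
    modNCyclotomicCharacter ℚ 5 (τ * τ) = 1 := by
  sorry

/-- **T1 (S−): equal actions on `W[n]` restrict to `W[d]` for `d ∣ n`** (`geomTorsion_le_of_dvd`;
used with `n = M := 8·∏_{p ∣ 2·3·5·11·Δ'} p` and `d ∈ {3, 5, 15}`). -/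
theorem helper_smul_eq_of_dvd (W : WeierstrassCurve ℚ) {d n : ℤ} (hdn : d ∣ n)
    {φ σ : absoluteGaloisGroup ℚ} (h : ∀ P : W.geomTorsion n, φ • P = σ • P)
    (P : W.geomTorsion d) : φ • P = σ • P := by
  sorry

/-- **R4′ (S− from gen-4 R4 at `σ·σ'⁻¹`): a character of exponent-2 target, unramified at the primes
not dividing `m` (`8 ∣ m`), takes equal values on elements with equal `χ̄_m`.**  Consumed with
`σ = φ` (the Chebotarev Frobenius), `σ' = σ₀ = τ²`, so `ψ(φ) = ψ(τ²) = 1` by XS. -/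
theorem helper_char_eq_of_cyclotomic_eq {M : Type*} [CommGroup M] (hM : ∀ x : M, x ^ 2 = 1)
    (ψ : absoluteGaloisGroup ℚ →* M)
    (hker : IsOpen ((ψ.ker : Subgroup (absoluteGaloisGroup ℚ)) : Set (absoluteGaloisGroup ℚ)))
    {m : ℕ} [NeZero m] (h8 : 8 ∣ m)
    (hunr : ∀ (v : HeightOneSpectrum (𝓞 ℚ)), ¬ (Rat.HeightOneSpectrum.primesEquiv v : ℕ) ∣ m →
      ∀ 𝔓 ∈ v.primesAbove, ∀ τ ∈ 𝔓.inertia (absoluteGaloisGroup ℚ), ψ τ = 1)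
    {σ σ' : absoluteGaloisGroup ℚ}
    (hσ : modNCyclotomicCharacter ℚ m σ = modNCyclotomicCharacter ℚ m σ') : ψ σ = ψ σ' := by
  sorry

/-! ## (V) + (L0): the cusp-adjacent member is multiplicative at `q` with `v_q(Δ_min) = 5` -/

/-- **VAL (S−, NEW; elementary): `v_q(a³ − b²) = 5 ⇒ q ∤ a`.**  If `q ∣ a`: `q ∤ b` gives
`v(a³−b²) = 0`; `q ∣ b` gives `v(a³−b²) = min(3v(a), 2v(b)) ∈ {2,3,4,6,…}` when `3v(a) ≠ 2v(b)` and
`≥ 6` when they agree — never `5`. -/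
theorem helper_not_dvd_of_padicValInt_cube_sub_sq {q : ℕ} (hq : q.Prime) (a b : ℤ)
    (h : padicValInt q (a ^ 3 - b ^ 2) = 5) : ¬ (q : ℤ) ∣ a := by
  sorry

/-- rational form of VAL for `q`-integral `a, b` (S−; what L1 consumes, `a = 𝔠₄(l,1)`, `b = 𝔠₆(l,1)`). -/
theorem helper_padicValRat_eq_zero_of_cube_sub_sq {q : ℕ} [Fact q.Prime] (a b : ℚ)
    (ha : 0 ≤ padicValRat q a) (hb : 0 ≤ padicValRat q b) (hab : a ^ 3 ≠ b ^ 2)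
    (h : padicValRat q (a ^ 3 - b ^ 2) = 5) : padicValRat q a = 0 := by
  sorry

set_option maxHeartbeats 8000000 in
/-- **L0 (PROVED in the kernel, NEW in gen 5): Fisher's syzygy `𝔠₄³ − 𝔠₆² = (c₄³ − c₆²)·𝔇⁵` at
`μ = 1`** ([Fisher2012Hessian] §8; previously "checked outside the kernel" per
`Fisher2012/HesseFamilyFiveClosedForms.lean`).  `field_simp; ring`, ≈ 70 s on the farm. -/
theorem hesse_syzygy_five_m1 (c₄ c₆ l : ℚ) :
    C4 c₄ c₆ l 1 ^ 3 - C6 c₄ c₆ l 1 ^ 2 = (c₄ ^ 3 - c₆ ^ 2) * D c₄ c₆ l 1 ^ 5 := by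
  simp only [C4, C6, C4l, C4m, D, Dl, Dm, Dll, Dlm, Dmm, Dlll, Dllm, Dlmm, Dmmm]
  field_simp
  ring

/-- **Δ and c₄ of a member (PROVED): `c₄(E_{l,m}) = 6⁴𝔠₄`, `Δ(E_{l,m}) = 2⁶3⁹(𝔠₄³ − 𝔠₆²)`.** -/
theorem member_c₄ (c₄ c₆ l m : ℚ) : (member c₄ c₆ l m).c₄ = 6 ^ 4 * C4 c₄ c₆ l m := by
  simp only [WeierstrassCurve.c₄, WeierstrassCurve.b₂, WeierstrassCurve.b₄]; ring

theorem member_Δ (c₄ c₆ l m : ℚ) :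
    (member c₄ c₆ l m).Δ = 2 ^ 6 * 3 ^ 9 * (C4 c₄ c₆ l m ^ 3 - C6 c₄ c₆ l m ^ 2) := by
  simp only [WeierstrassCurve.Δ, WeierstrassCurve.b₂, WeierstrassCurve.b₄, WeierstrassCurve.b₆,
    WeierstrassCurve.b₈]; ring

/-- hence (PROVED): `Δ(E_{l,1}) = 2⁶·3⁹·(c₄³ − c₆²)·𝔇(l,1)⁵`. -/
theorem member_Δ_eq (c₄ c₆ l : ℚ) :
    (member c₄ c₆ l 1).Δ = 2 ^ 6 * 3 ^ 9 * ((c₄ ^ 3 - c₆ ^ 2) * D c₄ c₆ l 1 ^ 5) := by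
  rw [member_Δ, hesse_syzygy_five_m1]

/-- **L1 (S given VAL + L0; gen-2 signature with `11` added to the excluded primes):** the member at an
integer `l` with `v_q(𝔇(l,1)) = 1`, `q ∤ 2·3·5·11·(c₄³−c₆²)`, is multiplicative at `q` with
`v_q(Δ_min) = 5`.  Route: `𝔠₄(l,1), 𝔠₆(l,1)` are `q`-integral (denominators `17424·240 ∣ (2·3·5·11)^∞`);
`v_q(Δ) = 0 + 5·1 = 5` (`member_Δ_eq`); VAL ⇒ `v_q(c₄(E)) = 0` (`member_c₄`); an integral model with
`v(c₄) = 0 < v(Δ)` is minimal and multiplicative (tree road of `Rank1Residual.O6.multiplicative_of_unit_c4`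
/ `MinimalDiscriminant`). -/
theorem helper_member_multiplicative (c₄ c₆ l : ℤ) (hΔ : c₄ ^ 3 ≠ c₆ ^ 2) {q : ℕ} (hq : q.Prime)
    (hq0 : ¬ (q : ℤ) ∣ 330 * (c₄ ^ 3 - c₆ ^ 2)) (hl : padicValInt q (D c₄ c₆ l 1) = 1)
    {v : HeightOneSpectrum (𝓞 ℚ)} (hv : (Rat.HeightOneSpectrum.primesEquiv v : ℕ) = q) :
    ∃ (_ : (member (c₄ : ℚ) c₆ l 1).IsElliptic),
      (member (c₄ : ℚ) c₆ l 1).HasMultiplicativeReductionAt v ∧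
      (member (c₄ : ℚ) c₆ l 1).ordMinimalDiscriminant v = 5 := by
  sorry

/-! ## (F) separability with the exact constant (statement unchanged from gen 4; constant now exact) -/

/-- **C1s′ (M− kernel certificate OR named fact `HessePolynomialSeparable` of gen 4):** for a prime
`q ∤ 30(c₄³−c₆²)` a root of `𝔇(·,1)` mod `q` is simple.  Certificate: a Bézout identity
`U·𝔇 + V·∂_λ𝔇 = 2¹³²3⁶⁶5²⁵(c₄³−c₆²)²²` in `ℤ[c₄,c₆,λ]` (`deg_λ U ≤ 10`, `deg_λ V ≤ 11`; the constant is
the exact discriminant, `calc/disc_D_exact.py` (A)), provable by `ring` like L0. -/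
theorem helper_simple_root_mod_q (c₄ c₆ r : ℤ) {q : ℕ} (hq : q.Prime)
    (hq30 : ¬ (q : ℤ) ∣ 30 * (c₄ ^ 3 - c₆ ^ 2)) (hr : (q : ℤ) ∣ D c₄ c₆ r 1) :
    ¬ (q : ℤ) ∣ Dl c₄ c₆ r 1 := by
  sorry

/-! ## sanity: the tree inputs the assembly consumes exist with the expected shape -/

example : chebotarev_geomTorsion := chebotarev_geomTorsion_holds

example (E : WeierstrassCurve ℚ) [E.IsElliptic] {v : HeightOneSpectrum (𝓞 ℚ)}
    (hmult : E.HasMultiplicativeReductionAt v) (h3v : ((3 : ℕ) : 𝓞 ℚ) ∉ v.asIdeal)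
    (h5 : E.ordMinimalDiscriminant v = 5) :
    3 ∣ Nat.card (galoisRepTorsion E ((3 : ℕ) : ℤ)).range :=
  E.dvd_card_range_galoisRepTorsion_of_hasMultiplicativeReductionAt_of_not_dvd hmult Nat.prime_three
    h3v (by rw [h5]; decide)

end Summit.ABC.ABC.Cruxes.FreyModularity.StubSwitchK2G5
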